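import Summits.HodgeConjecture.HodgeConjecture.Theorems.Ring2AbelianAllAndreLiebermanFourier
import HarnessLib

/-!
# Ring 2 · sub-cell AbelianAll (ALL ABELIAN VARIETIES), André axis, part XXXVII-f — THE POINCARÉ (MUMFORD) CLASS OF A POLARISED ABELIAN
# VARIETY INVERTS `L^{g-1}` ON `H¹`: for `ℓ = m^*θ − pr₁^*θ − pr₂^*θ ∈ N¹H²(A × A)`, `ℓ_*(x ∪ θ^{g-1}) = c₀ · x` for every `x ∈ H¹(A)`, `c₀ ≠ 0`

HONEST FRAMING (page 1, verbatim): **research route, not a corollary; conditional on HC_CM plus one named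
minimal statement.** Cell line: research route conditional on HC_CM; not a corollary; Q11.4-sentence-2
already refuted in dim ≥ 3. Nothing in this file proves a case of the Hodge conjecture for an abelian variety; `HC_CM` does not occur in
this file; item `Theses.RankFourFaces.CMToAbelian` (stmt-16267) OPEN and not closed here. Seat `pub-hodge-ring2-ab-andre-2`, gen 29;
brief (iii) "B for abelian varieties themselves is KNOWN — Lieberman/Kleiman … identify precisely why that does not suffice". This is the
FIBRE-LEVEL input of the middle Lefschetz block of part XXXVII: the degree-`-2(g-1)` inverse of the Lefschetz isomorphism
`L^{g-1} : H¹(A) ⥲ H^{2g-1}(A)` is induced, up to a non-zero scalar, by a DIVISOR class on `A × A` — the Poincaré class of the polarisation.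

## What is proved (theorems only; no definition, no named fact, no sorry; `HC_CM` absent)

For a complex abelian variety `A` of dimension `g = k + 1`, a polarisation class `η ∈ H²(A(ℂ); ℂ)` (`IsPolarizationClass`), a rational
`θ` with `θ ⊗ 1 = η`, a basis `b` of `H¹(A(ℂ); ℚ)` and the polar family `y` of `θ` along `b` (COR-CM model layer row M22:
`ℓ(θ) = m^*θ − pr₁^*θ − pr₂^*θ = Σ_a pr₁^* b_a ∪ pr₂^* y_a`, `exists_polClass_eq_sum`):

* `cupProduct_cupPow_cup_eq` — the reassociation `(x ∪ θᵏ) ∪ y = x ∪ (y ∪ θᵏ)` for degree-one `x, y` (`θᵏ` has even degree).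
* **`exists_polarClass_inverts_lefschetz`** — THE MAIN IDENTITY: there are `θ`, the complexified Poincaré class
  `ℓ = Σ_a pr₁^*(b_a ⊗ 1) ∪ pr₂^*(y_a ⊗ 1) = ℓ(θ) ⊗ 1 ∈ N¹ H²((A × A)(ℂ); ℂ)` (ALGEBRAIC: pull-backs of the algebraic `θ`) and `c₀ ≠ 0` with
  **`ℓ_*(x ∪ ηᵏ) = c₀ · x` for every `x ∈ H¹(A(ℂ); ℂ)`** (`ℓ_* = corrAction`, Voisin II (10.7), first factor receives). Proof: on the rational
  basis `x = b_{a'} ⊗ 1`, `(pr₁^* b_a ∪ pr₂^* y_a)_*(c) = −τ(c ∪ y_a) · b_a` (part XXII-a `exists_crossFunctional`), `τ(w ⊗ 1) = κ · tr(w)`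
  (`exists_eq_mul_tr`, `κ ≠ 0`), and `(k+1) · b_{a'} ∪ (y_a ∪ θᵏ) = δ_{a a'} θ^{k+1}` (COR-CM `smul_cup_polar_cup_cupPow`), so the sum collapses to
  `−κ · tr(θ^{k+1})/(k+1) · (b_{a'} ⊗ 1)` with `tr(θ^{k+1}) ≠ 0` (`θᵍ ≠ 0`, `tr` injective on the top line); rational classes span `H¹(A(ℂ); ℂ)`.
  Print: on an abelian variety `Λ`-type operators are Pontryagin / Fourier operators of the polarisation (Lieberman, Kleiman 2A8–2A11;
  Beauville–Künnemann `f = −(θ^{g-1}/(g-1)!) ⋆`); here only the degree-one piece is needed, where `H¹` is `L`-isotypic.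

## Honest status

A theorem about one abelian variety; no node; nothing minimal; N104 untouched. Consumer: part XXXVII-g (the middle block of a compact abelian
pencil from an algebraic class on the fibre square restricting to `ℓ`).

References: Kleiman1968AlgebraicCycles (App. to §2, 2A8–2A11); Lieberman1968 (pp. 366–374); MumfordAV1970 (§1 (4), §16, §20, §23 Riemann form);
Kunnemann1993 (§2); VoisinHodgeII2003 (proof of Thm. 10.17 (10.7)); HatcherAT2002 (§3.2 Prop. 3.10, Thm. 3.11, Thm. 3.15).
-/

noncomputable section

set_option linter.dupNamespace false

namespace Summit.HodgeConjecture.HodgeConjecture.Ring2.AbelianAll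

open CategoryTheory AlgebraicGeometry MonoidalCategory CartesianMonoidalCategory
open Literature.AlgebraicGeometry Literature.AlgebraicGeometry.Motives
open Literature.AlgebraicGeometry.HodgeTheory
open Literature.AlgebraicTopology.SingularHomology (singularCohomology cupProduct cupProduct_map cupProduct_assoc
  cupProduct_gradedComm_holds)
open Literature.AlgebraicTopology.CharacteristicClasses (cupPow)
open Literature.NumberTheory.Automorphic.PicardCM (ratAlgebraicClasses mem_ratAlgebraicClasses_iff)
open Summit.HodgeConjecture.CorCM.Model
open scoped MonObj

variable {Y : Type} [TopologicalSpace Y]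

/-- **`(x ∪ θᵏ) ∪ y = x ∪ (y ∪ θᵏ)` for `x, y ∈ H¹` and `θᵏ ∈ H^{2k}`** (associativity and graded commutativity in even degree).
[cite: HatcherAT2002, §3.2 Prop. 3.10 and Thm. 3.11] -/
theorem cupProduct_cupPow_cup_eq {R : Type} [CommRing R] {k : ℕ} (x y : singularCohomology R R Y 1)
    (P : singularCohomology R R Y (2 * k)) :
    cupProduct (show 1 + 2 * k + 1 = 2 * k + 1 + 1 by omega) (cupProduct (rfl : 1 + 2 * k = 1 + 2 * k) x P) y =
      cupProduct (Nat.add_comm 1 (2 * k + 1)) x (cupProduct (show 1 + 2 * k = 2 * k + 1 by omega) y P) := by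
  rw [cupProduct_assoc (rfl : 1 + 2 * k = 1 + 2 * k) (rfl : 2 * k + 1 = 2 * k + 1) (show 1 + 2 * k + 1 = 2 * k + 1 + 1 by omega)
      (Nat.add_comm 1 (2 * k + 1)) x P y,
    cupProduct_gradedComm_holds R Y (rfl : 2 * k + 1 = 2 * k + 1) (show 1 + 2 * k = 2 * k + 1 by omega) P y]
  simp

/-- **THE POINCARÉ CLASS OF A POLARISATION INVERTS `L^{g-1}` ON `H¹`, UP TO A NON-ZERO SCALAR.** Let `A` be a complex abelian variety of
dimension `g = k + 1` (`hA : IsSmoothProjective (k+1) A.X`, `hk : k + 1 = A.dim`) and `ηA` a polarisation class. There are a rational `θ` with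
`θ ⊗ 1 = ηA`, the complexified Poincaré class `ℓ = ℓ(θ) ⊗ 1` (`ℓ(θ) = m^*θ − pr₁^*θ − pr₂^*θ`) — an ALGEBRAIC divisor class on `A × A` — and
`c₀ ≠ 0` with **`ℓ_*(x ∪ ηAᵏ) = c₀ · x` for every `x ∈ H¹(A(ℂ); ℂ)`** (`ℓ_*` = `corrAction`, Voisin II (10.7), first factor receives).
[cite: Kleiman1968AlgebraicCycles, Appendix to §2, 2A8–2A11] [cite: MumfordAV1970, §1 (4), §16 and §20] [cite: Lieberman1968, pp. 366–374]
[cite: VoisinHodgeII2003, proof of Thm. 10.17 (10.7)] -/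
theorem exists_polarClass_inverts_lefschetz (A : AbelianVariety ℂ) {k : ℕ} (hk : k + 1 = A.dim) (hA : IsSmoothProjective (k + 1) A.X)
    {ηA : complexBetti A.X 2} (hηA : IsPolarizationClass (k + 1) A.X ηA) :
    ∃ (θ : bettiCohomology A.X 2) (ℓ : complexBetti (A.X ⊗ A.X) 2) (c₀ : ℂ),
      ofRatClass (ComplexPoints A.X) 2 θ = ηA ∧
      ℓ = ofRatClass (ComplexPoints (A.X ⊗ A.X)) 2
        (BettiUniverse.pull μ[A.X] 2 θ - BettiUniverse.pull (fst A.X A.X) 2 θ - BettiUniverse.pull (snd A.X A.X) 2 θ) ∧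
      ℓ ∈ algebraicClasses (A.X ⊗ A.X) 1 ∧ c₀ ≠ 0 ∧
      ∀ x : complexBetti A.X 1,
        corrAction complexOrientationFamily hA hA (show 1 + 2 * k + 2 * 1 = 1 + 2 * (k + 1) by omega) ℓ
          (cupProduct (rfl : 1 + 2 * k = 1 + 2 * k) x (cupPow ℂ ηA k)) = c₀ • x := by
  classical
  -- `ηA = θ ⊗ 1`, `θ` rational algebraic with `θ^g ≠ 0`
  obtain ⟨θ, hθ⟩ := (isRationalClass_iff_mem_range_ofRatClass ηA).1 hηA.isRationalClass
  have hθalg : θ ∈ ratAlgebraicClasses A.X 1 := by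
    rw [mem_ratAlgebraicClasses_iff]
    change ofRatClass (ComplexPoints A.X) 2 θ ∈ algebraicClasses A.X 1
    rw [hθ]
    exact hηA.mem_algebraicClasses
  have hθtop : cupPow ℚ θ (k + 1) ≠ 0 := cupPow_ne_zero_of_hasHardLefschetz hA θ (by rw [hθ]; exact hηA.hasHardLefschetz)
  -- a basis `b` of `H¹(A(ℂ); ℚ)` and the polar family `y`
  haveI : FiniteDimensional ℚ (bettiCohomology A.X 1) := finiteDimensional_bettiCohomology hA 1
  let b : Module.Basis (Fin (Module.finrank ℚ (bettiCohomology A.X 1))) ℚ (bettiCohomology A.X 1) := Module.finBasis ℚ _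
  set N := Module.finrank ℚ (bettiCohomology A.X 1) with hN
  obtain ⟨y, hℓ⟩ := exists_polClass_eq_sum A b θ
  -- the complexified Poincaré class
  set ℓ : complexBetti (A.X ⊗ A.X) 2 :=
    ∑ a, cupProduct (rfl : 1 + 1 = 2) (complexBetti.map (fst A.X A.X) 1 (ofRatClass (ComplexPoints A.X) 1 (b a)))
      (complexBetti.map (snd A.X A.X) 1 (ofRatClass (ComplexPoints A.X) 1 (y a))) with hℓdef
  have hℓrat : ℓ = ofRatClass (ComplexPoints (A.X ⊗ A.X)) 2
      (BettiUniverse.pull μ[A.X] 2 θ - BettiUniverse.pull (fst A.X A.X) 2 θ - BettiUniverse.pull (snd A.X A.X) 2 θ) := by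
    rw [hℓ, map_sum]
    refine Finset.sum_congr rfl fun a _ ↦ ?_
    rw [ofRatClass_cupProduct, ofRatClass_pull, ofRatClass_pull]
  have hℓalg : ℓ ∈ algebraicClasses (A.X ⊗ A.X) 1 := by
    have h := polClass_mem_ratAlgebraicClasses A hθalg
    rw [mem_ratAlgebraicClasses_iff] at h
    rw [hℓrat]
    exact h
  -- the cross functional and its rational comparison
  obtain ⟨τ, hτ0, hτ⟩ := exists_crossFunctional hA hA
  obtain ⟨κ, hκ⟩ := exists_eq_mul_tr hA τ
  have hκ0 : κ ≠ 0 := by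
    intro hκ0
    have hzero : ∀ w : bettiCohomology A.X (2 * (k + 1)), ofRatClass (ComplexPoints A.X) (2 * (k + 1)) w = 0 := fun w ↦
      hτ0 _ (by rw [hκ w, hκ0, zero_mul])
    haveI : FiniteDimensional ℚ (bettiCohomology A.X (2 * (k + 1))) := finiteDimensional_bettiCohomology hA (2 * (k + 1))
    have h1 : Module.finrank ℚ (bettiCohomology A.X (2 * (k + 1))) = 1 := finrank_rat_top hA
    obtain ⟨w, hw⟩ := (Module.finrank_pos_iff_exists_ne_zero (R := ℚ) (M := bettiCohomology A.X (2 * (k + 1)))).1 (by omega)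
    exact hw (ofRatClass_injective (Y := ComplexPoints A.X) (2 * (k + 1)) (by rw [hzero w, map_zero]))
  have htr : (BettiUniverse.tr hA (2 * (k + 1)) (cupPow ℚ θ (k + 1)) : ℂ) ≠ 0 := by
    exact_mod_cast fun h ↦ hθtop (tr_top_injective hA (by rw [h, map_zero]))
  have hk1 : ((k + 1 : ℕ) : ℂ) ≠ 0 := by exact_mod_cast Nat.succ_ne_zero k
  -- the scalar
  set c₀ : ℂ := (-1 : ℂ) ^ ((1 + 2 * k) * 1) * κ * (((k + 1 : ℕ) : ℚ)⁻¹ : ℚ) *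
    (BettiUniverse.tr hA (2 * (k + 1)) (cupPow ℚ θ (k + 1)) : ℂ) with hc₀
  have hak : 1 + 2 * k + 1 = 2 * (k + 1) := by omega
  -- the identity on the rational basis
  have hterm : ∀ a a' : Fin N,
      corrAction complexOrientationFamily hA hA (show 1 + 2 * k + 2 * 1 = 1 + 2 * (k + 1) by omega)
        (cupProduct (rfl : 1 + 1 = 2) (complexBetti.map (fst A.X A.X) 1 (ofRatClass (ComplexPoints A.X) 1 (b a)))
          (complexBetti.map (snd A.X A.X) 1 (ofRatClass (ComplexPoints A.X) 1 (y a))))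
        (cupProduct (rfl : 1 + 2 * k = 1 + 2 * k) (ofRatClass (ComplexPoints A.X) 1 (b a')) (cupPow ℂ ηA k)) =
      (if a' = a then c₀ else 0) • ofRatClass (ComplexPoints A.X) 1 (b a) := by
    intro a a'
    rw [hτ (rfl : 1 + 1 = 2) (show 1 + 2 * k + 2 * 1 = 1 + 2 * (k + 1) by omega) hak]
    congr 1
    -- `c ∪ (y_a ⊗ 1) = (b_{a'} ∪ (y_a ∪ θᵏ)) ⊗ 1`
    have hcup : cupProduct hak (cupProduct (rfl : 1 + 2 * k = 1 + 2 * k) (ofRatClass (ComplexPoints A.X) 1 (b a')) (cupPow ℂ ηA k))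
        (ofRatClass (ComplexPoints A.X) 1 (y a)) =
        ofRatClass (ComplexPoints A.X) (2 * (k + 1)) (cupProduct (Nat.add_comm 1 (2 * k + 1)) (b a')
          (cupProduct (show 1 + 2 * k = 2 * k + 1 by omega) (y a) (cupPow ℚ θ k))) := by
      rw [← hθ, cupPow_complex_eq_cupPowTwo, ← ofRatClass_cupPow, ← ofRatClass_cupProduct, ← ofRatClass_cupProduct]
      exact congrArg _ (cupProduct_cupPow_cup_eq _ _ _)
    rw [hcup, hκ]
    -- the polar identity `(k+1) • b_{a'} ∪ (y_a ∪ θᵏ) = δ · θ^{k+1}`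
    have hne : ((k + 1 : ℕ) : ℚ) ≠ 0 := by exact_mod_cast Nat.succ_ne_zero k
    have hpol : cupProduct (Nat.add_comm 1 (2 * k + 1)) (b a') (cupProduct (show 1 + 2 * k = 2 * k + 1 by omega) (y a) (cupPow ℚ θ k)) =
        ((k + 1 : ℕ) : ℚ)⁻¹ • (if a' = a then cupPow ℚ θ (k + 1) else 0) := by
      rw [← smul_cup_polar_cup_cupPow A hk b hℓ a' a, smul_smul, inv_mul_cancel₀ hne, one_smul]
    rw [hpol, map_smul]
    split_ifs with h
    · rw [hc₀, smul_eq_mul]; push_cast; ring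
    · rw [map_zero, smul_zero, Rat.cast_zero, mul_zero, mul_zero]
  have hbasis : ∀ a' : Fin N,
      corrAction complexOrientationFamily hA hA (show 1 + 2 * k + 2 * 1 = 1 + 2 * (k + 1) by omega) ℓ
        (cupProduct (rfl : 1 + 2 * k = 1 + 2 * k) (ofRatClass (ComplexPoints A.X) 1 (b a')) (cupPow ℂ ηA k)) =
      c₀ • ofRatClass (ComplexPoints A.X) 1 (b a') := by
    intro a'
    rw [hℓdef, map_sum, LinearMap.sum_apply, Finset.sum_congr rfl fun a _ ↦ hterm a a']
    simp only [ite_smul, zero_smul, Finset.sum_ite_eq, Finset.mem_univ, if_true]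
  refine ⟨θ, ℓ, c₀, hθ, hℓrat, hℓalg, ?_, fun x ↦ ?_⟩
  · rw [hc₀]
    refine mul_ne_zero (mul_ne_zero (mul_ne_zero (pow_ne_zero _ (neg_ne_zero.2 one_ne_zero)) hκ0) ?_) htr
    exact_mod_cast inv_ne_zero (by exact_mod_cast Nat.succ_ne_zero k : ((k + 1 : ℕ) : ℚ) ≠ 0)
  · -- extend from the rational basis by linearity: rational classes span `H¹(A(ℂ); ℂ)`
    have hspan : x ∈ Submodule.span ℂ (Set.range fun a ↦ ofRatClass (ComplexPoints A.X) 1 (b a)) := by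
      have htop := span_isRationalClass_eq_top_of_isSmoothProjective_holds (k + 1) A.X hA 1
      have hx : x ∈ Submodule.span ℂ {c : complexBetti A.X 1 | IsRationalClass c} := by rw [htop]; exact Submodule.mem_top
      refine (Submodule.span_le.2 ?_) hx
      intro c hc
      obtain ⟨w, rfl⟩ := (isRationalClass_iff_mem_range_ofRatClass c).1 hc
      rw [← b.sum_repr w, map_sum]
      refine Submodule.sum_mem _ fun a _ ↦ ?_
      rw [ofRatClass_smul]
      exact Submodule.smul_mem _ _ (Submodule.subset_span ⟨a, rfl⟩)
    refine Submodule.span_induction (p := fun x _ ↦ corrAction complexOrientationFamily hA hA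
        (show 1 + 2 * k + 2 * 1 = 1 + 2 * (k + 1) by omega) ℓ (cupProduct (rfl : 1 + 2 * k = 1 + 2 * k) x (cupPow ℂ ηA k)) = c₀ • x)
      ?_ ?_ ?_ ?_ hspan
    · rintro _ ⟨a', rfl⟩
      exact hbasis a'
    · rw [LinearMap.map_zero₂, map_zero, smul_zero]
    · intro u v _ _ hu hv
      rw [LinearMap.map_add₂, map_add, hu, hv, smul_add]
    · intro c u _ hu
      rw [LinearMap.map_smul₂, map_smul, hu, smul_comm]

end Summit.HodgeConjecture.HodgeConjecture.Ring2.AbelianAll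

end
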